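import Mathlib
import Summits.Ventures.HodgeRepro2.Tier7.Line3.RealDominant
import Summits.Ventures.HodgeRepro2.Tier7.Datum.AbelianShadow

/-!
# Tier7/Line3/RealDominantDatum — the per-datum test, clause (iii), for the version-(ii) obligation shape
(t7-L1-p1, gen 2)

Ruling (A′) (t7-lead l. 14651) asks of every obligation shape the three-clause per-datum test: (i) it fails in the
junk datum, (ii) its relation to `C(D)` on the abstract datum, (iii) NON-VACUITY — it holds on a concrete datum built in
the kernel. For the version-(ii) shape `Line3.RealDominant D` (Tier7/Line3/RealDominant.lean, p672591): (i) and (ii)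
are inherited from `RtfConclusion D` through `realDominant_iff_rtfConclusion` (`not_realDominant_of_not_rtfConclusion`
is generic); clause (iii) is the theorem below on the non-vacuity datum `datumA` (Tier7/Datum/AbelianShadow.lean,
p667560: `A ⊗[ℂ] A′` of two curve algebras with the antilinear swap, `G = Unit`), from p1's `rtfConclusion_datumA`.

Nothing about the real objects; no non-vanishing device (§8(d): NO). Sorry-free; axioms: propext / Classical.choice /
Quot.sound.
-/

namespace Summit.Ventures.HodgeRepro2.Tier7

open Summit.Ventures.HodgeRepro2.T6

namespace Line3

/-- **clause (iii) for the version-(ii) shape**: the non-vacuity datum `datumA` carries a `RealDominantData` — through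
the iff and p1's `rtfConclusion_datumA`; the witness is the one-point `DominantSide.trivial` over `seesawDataA`'s single
label, so the shape is inhabited on a kernel-built datum whose conclusion `C(datumA)` is a theorem (`concl_datumA`). -/
theorem realDominant_datumA : RealDominant DatumA.datumA :=
  (realDominant_iff_rtfConclusion DatumA.datumA).2 DatumA.rtfConclusion_datumA

/-- the chain evaluated on `datumA`: its conclusion through the version-(ii) shape (a second route to `concl_datumA`). -/
theorem exists_translates_datumA_of_realDominant :
    ∃ g : Fin 4 → Unit, DatumA.datumA.S.L2 (DatumA.datumA.fOmegaS g) (DatumA.datumA.fOmegaSbar g) ≠ 0 :=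
  exists_translates_of_realDominant DatumA.datumA realDominant_datumA

end Line3

end Summit.Ventures.HodgeRepro2.Tier7
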